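import Literature.Probability.Independence.HoeffdingDecomposition
import HarnessLib

/-!
# Hoeffding's decomposition — transport of the averaging operators under coordinate maps

Continuation of `HoeffdingDecomposition.lean`.  Source: B. Efron, C. Stein, Ann. Statist. 9 (1981), §2 (the ANOVA decomposition
is natural: relabelling the independent variables relabels the parts; a statistic of a sub-family is decomposed inside that
sub-family), W. Hoeffding, Ann. Math. Statist. 19 (1948), §5.  For the product `ι → β` of copies of ONE probability space `(β, μ)`:
* `condAvg_insert` — peel one integral: `E_{insert i A} f (x) = ∫ E_A f (update x i b) dμ(b)`;
* pull-back along an INJECTION of index sets `e : ι → ι'`, `f ↦ f ∘ (· ∘ e)`: `dependsOff_comp_of_injective`,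
  `condAvg_comp_image` (`E_{e(A)} (f ∘ (·∘e)) = (E_A f) ∘ (·∘e)`), `condAvg_comp_of_injective` (general `A'`: preimage),
  `integral_comp_of_injective` (`∫ f(x'∘e) dμ^{⊗ι'} = ∫ f dμ^{⊗ι}` — marginalisation of a probability product);
* COORDINATEWISE measure-preserving maps `Φ(x)_i = φ_i(x_i)`: `condAvg_comp_coordwise` (`E_A (f ∘ Φ) = (E_A f) ∘ Φ`).
(Instances in the tree's consumer: lattice translations = index permutations; deletion of coordinates = injections; gauge
transformations = coordinatewise two-sided Haar translations.)  No instances, no notation; standard axioms.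
-/

set_option autoImplicit false

noncomputable section

open MeasureTheory Finset Function

namespace Literature.Probability.Independence.Hoeffding

variable {ι : Type*} [DecidableEq ι] {β : Type*} [MeasurableSpace β]
variable {μ : Measure β} [IsProbabilityMeasure μ] {f : (ι → β) → ℝ}

/-- **Peeling one coordinate**: `E_{insert i A} f (x) = ∫ (E_A f)(update x i b) dμ(b)` for `i ∉ A` (bounded measurable `f`).
[cite: EfronStein1981, §2] -/
theorem condAvg_insert {i : ι} {A : Finset ι} (hi : i ∉ A) (hf : Measurable f) {C : ℝ} (hC : ∀ x, |f x| ≤ C) :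
    condAvg μ (insert i A) f = fun x => ∫ b, condAvg μ A f (Function.update x i b) ∂μ := by
  rw [Finset.insert_eq, condAvg_union (Finset.disjoint_singleton_left.2 hi) hf hC, condAvg_singleton]

section Injective

variable {ι' : Type*} [DecidableEq ι'] {e : ι → ι'}

omit [DecidableEq ι] [IsProbabilityMeasure μ] [MeasurableSpace β] [DecidableEq ι'] in
/-- Pulling back along an injection of index sets: `f ∘ (· ∘ e)` does not depend on a set of coordinates whose `e`-preimage
`f` does not depend on. [cite: EfronStein1981, §2] -/
theorem dependsOff_comp_of_injective {A' : Finset ι'} {B : Finset ι} (hB : DependsOff B f)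
    (hAB : ∀ i, e i ∈ A' → i ∈ B) : DependsOff A' (fun x' : ι' → β => f (x' ∘ e)) := by
  intro x' y' h
  refine hB _ _ fun i hi => ?_
  simp only [Function.comp_apply]
  exact h (e i) fun he => hi (hAB i he)

omit [DecidableEq ι] [DecidableEq ι'] [IsProbabilityMeasure μ] in
/-- Measurability of the pull-back. [cite: EfronStein1981, §2] -/
theorem measurable_comp_restrict (hf : Measurable f) : Measurable fun x' : ι' → β => f (x' ∘ e) :=
  hf.comp (measurable_pi_iff.mpr fun i => measurable_pi_apply (e i))

/-- **Transport along an injection, image form**: `E_{e(A)} (f ∘ (·∘e)) (x') = (E_A f)(x' ∘ e)`.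
[cite: EfronStein1981, §2] -/
theorem condAvg_comp_image (he : Injective e) (hf : Measurable f) {C : ℝ} (hC : ∀ x, |f x| ≤ C) (A : Finset ι)
    (x' : ι' → β) : condAvg μ (A.image e) (fun z' : ι' → β => f (z' ∘ e)) x' = condAvg μ A f (x' ∘ e) := by
  have hf' : Measurable fun z' : ι' → β => f (z' ∘ e) := measurable_comp_restrict hf
  have hC' : ∀ z' : ι' → β, |f (z' ∘ e)| ≤ C := fun z' => hC _
  induction A using Finset.induction_on generalizing x' with
  | empty => simp
  | insert i A hiA ih =>
    rw [Finset.image_insert, condAvg_insert (mt Finset.mem_image.1 ?_) hf' hC', condAvg_insert hiA hf hC]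
    · simp only
      congr 1
      funext b
      rw [ih, update_comp_eq_of_injective x' he i b]
    · rintro ⟨j, hj, hji⟩
      exact hiA (he hji ▸ hj)

variable [Fintype ι]

/-- **Transport along an injection, general form**: `E_{A'} (f ∘ (·∘e)) (x') = (E_{e⁻¹A'} f)(x' ∘ e)`.
[cite: EfronStein1981, §2] -/
theorem condAvg_comp_of_injective (he : Injective e) (hf : Measurable f) {C : ℝ} (hC : ∀ x, |f x| ≤ C) (A' : Finset ι')
    (x' : ι' → β) :
    condAvg μ A' (fun z' : ι' → β => f (z' ∘ e)) x' = condAvg μ (univ.filter fun i => e i ∈ A') f (x' ∘ e) := by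
  set A : Finset ι := univ.filter fun i => e i ∈ A' with hA
  have hsub : A.image e ⊆ A' := by
    intro i' hi'
    obtain ⟨i, hi, rfl⟩ := Finset.mem_image.1 hi'
    exact (Finset.mem_filter.1 hi).2
  -- the coordinates of `A'` outside `e(A)` are invisible to `f ∘ (·∘e)`
  have hdep : DependsOff (A' \ A.image e) (fun z' : ι' → β => f (z' ∘ e)) := by
    refine dependsOff_comp_of_injective (B := ∅) (fun x y _ => ?_) fun i hi => ?_
    · congr 1
      funext j
      exact ‹∀ i, i ∉ (∅ : Finset ι) → x i = y i› j (Finset.notMem_empty j)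
    · exfalso
      rw [Finset.mem_sdiff] at hi
      exact hi.2 (Finset.mem_image.2 ⟨i, Finset.mem_filter.2 ⟨Finset.mem_univ _, hi.1⟩, rfl⟩)
  rw [condAvg_eq_condAvg_sdiff hdep (measurable_comp_restrict hf) (fun z' => hC _),
    Finset.sdiff_sdiff_eq_self hsub, condAvg_comp_image he hf hC]

/-- **Marginalisation of a probability product**: `∫ f(x' ∘ e) dμ^{⊗ι'} = ∫ f dμ^{⊗ι}` for an injection `e : ι → ι'`
(bounded measurable `f`). [cite: EfronStein1981, §2] -/
theorem integral_comp_of_injective [Fintype ι'] (he : Injective e) (hf : Measurable f) {C : ℝ} (hC : ∀ x, |f x| ≤ C) :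
    ∫ x', f (x' ∘ e) ∂(Measure.pi fun _ : ι' => μ) = ∫ x, f x ∂(Measure.pi fun _ : ι => μ) := by
  haveI : Nonempty β := nonempty_of_isProbabilityMeasure μ
  obtain ⟨x'⟩ : Nonempty (ι' → β) := inferInstance
  have h1 := congrFun (condAvg_univ (μ := μ) fun z' : ι' → β => f (z' ∘ e)) x'
  have h2 := congrFun (condAvg_univ (μ := μ) f) (x' ∘ e)
  rw [← h1, ← h2, condAvg_comp_of_injective he hf hC]
  congr 1
  ext i
  simp

end Injective

section Coordwise

variable {φ : ι → β → β}

omit [DecidableEq ι] [IsProbabilityMeasure μ] [MeasurableSpace β] in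
/-- A coordinatewise map preserves «does not depend on `A`». [cite: EfronStein1981, §2] -/
theorem dependsOff_comp_coordwise {A : Finset ι} (h : DependsOff A f) :
    DependsOff A (fun x : ι → β => f (fun i => φ i (x i))) := fun x y hxy =>
  h _ _ fun i hi => by simp only [hxy i hi]

omit [DecidableEq ι] [IsProbabilityMeasure μ] in
/-- Measurability of the coordinatewise pull-back. [cite: EfronStein1981, §2] -/
theorem measurable_comp_coordwise (hφ : ∀ i, Measurable (φ i)) (hf : Measurable f) :
    Measurable fun x : ι → β => f (fun i => φ i (x i)) :=
  hf.comp (measurable_pi_iff.mpr fun i => (hφ i).comp (measurable_pi_apply i))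

/-- **Transport under coordinatewise measure-preserving maps**: `E_A (f ∘ Φ) = (E_A f) ∘ Φ` for `Φ(x)_i = φ_i(x_i)` with every
`φ_i` `μ`-preserving (measurable `f`). [cite: EfronStein1981, §2] -/
theorem condAvg_comp_coordwise (hφ : ∀ i, MeasurePreserving (φ i) μ μ) (hf : Measurable f) (A : Finset ι) (x : ι → β) :
    condAvg μ A (fun z : ι → β => f (fun i => φ i (z i))) x = condAvg μ A f (fun i => φ i (x i)) := by
  unfold condAvg
  -- `Φ (updateFinset x A y) = updateFinset (Φ x) A (Ψ y)` with `Ψ` coordinatewise on `A → β`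
  let Ψ : (↥A → β) → (↥A → β) := fun y a => φ a (y a)
  have hΨ : MeasurePreserving Ψ (Measure.pi fun _ : ↥A => μ) (Measure.pi fun _ : ↥A => μ) :=
    measurePreserving_pi (fun _ : ↥A => μ) (fun _ : ↥A => μ) fun a => hφ a
  have hupd : ∀ y : ↥A → β, (fun i => φ i (updateFinset x A y i)) = updateFinset (fun i => φ i (x i)) A (Ψ y) := by
    intro y
    funext i
    by_cases hi : i ∈ A <;> simp [updateFinset, hi, Ψ]
  simp_rw [hupd]
  have hg : AEStronglyMeasurable (fun y : ↥A → β => f (updateFinset (fun i => φ i (x i)) A y))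
      (Measure.map Ψ (Measure.pi fun _ : ↥A => μ)) :=
    (hf.comp measurable_updateFinset).aestronglyMeasurable
  rw [← integral_map hΨ.measurable.aemeasurable hg, hΨ.map_eq]

end Coordwise

end Literature.Probability.Independence.Hoeffding
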